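import Literature.AlgebraicTopology.Homotopy.LinearActionSpheres
import HarnessLib

/-!
# Linear changes of coordinates act on `πₖ(X, x₀)` by the sign of the determinant, II

Topic `Literature/AlgebraicTopology/Homotopy`, second half of `LinearActionSpheres.lean`
(precomposition `CSphere.precompLin φ M hM` of compactly supported spheres with invertible
linear maps; shears preserve the class, reversing a coordinate inverts it). Here:

* `CSphere.toClass_precompLin_diagonal_pos`, `…_diagonal_sign`, `…_diagonal`: invertible
  diagonal matrices act by the sign of the determinant (positive entries are joined to `1`;
  each entry `-1` is one `negMatrix`, i.e. one inversion);
* `CSphere.toClass_precompLin`: **`toClass (φ ∘ M) = (toClass φ) ^ signDet M`** for every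
  `M` with `det M ≠ 0`, by Mathlib's `Matrix.diagonal_transvection_induction_of_det_ne_zero`
  (every invertible matrix is a product of transvections and an invertible diagonal matrix);
* `CSphere.translate`, `toClass_translate`: translations do not change the class;
  `CSphere.AffMap` (affine changes of coordinates `y ↦ lin y + shift`, with `comp` and the
  preservation of affine combinations) and `CSphere.toClass_precompAff`: an invertible affine
  change of coordinates acts by the sign of the determinant of its linear part.

Everything is proved; `[folklore]` (the two path components of `GLₖ(ℝ)` are told apart by
`sign det`; Hatcher, *Algebraic Topology* (2002), §4.1, pp. 340–342 for the action on `πₙ`).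

## References

* A. Hatcher, *Algebraic Topology*, CUP (2002), §4.1, pp. 340–342. [HatcherAT2002]
-/

noncomputable section

open Set Metric unitInterval Topology Matrix
open scoped Topology.Homotopy

universe u

namespace Literature.AlgebraicTopology.Homotopy

namespace CSphere

variable {k : ℕ} {X : Type u} [TopologicalSpace X] {x₀ : X}

/-! #### Diagonal matrices -/

/-- Diagonal matrices with positive entries do not change the class (joined to the identity).
[folklore] -/
theorem toClass_precompLin_diagonal_pos [NeZero k] (φ : CSphere k X x₀) {d : Fin k → ℝ}
    (hd : ∀ i, 0 < d i) {h} : (precompLin φ (diagonal d) h).toClass = φ.toClass := by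
  -- uniform coercivity constant `∑ 1 / min 1 (d j)`
  set C : ℝ := ∑ j, 1 / min 1 (d j) with hC
  have hm : ∀ j, 0 < min 1 (d j) := fun j => lt_min one_pos (hd j)
  have hCnn : 0 ≤ C := Finset.sum_nonneg fun j _ => (one_div_pos.2 (hm j)).le
  have hcoer : ∀ s ∈ Icc (0 : ℝ) 1, ∀ y : Fin k → ℝ,
      ‖y‖ ≤ C * ‖diagonal (fun i => (1 - s) + s * d i) *ᵥ y‖ := by
    intro s hs y
    set z := diagonal (fun i => (1 - s) + s * d i) *ᵥ y with hz
    refine (pi_norm_le_iff_of_nonneg (mul_nonneg hCnn (norm_nonneg _))).2 fun i => ?_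
    have hzi : z i = ((1 - s) + s * d i) * y i := by rw [hz, mulVec_diagonal]
    have hds : min 1 (d i) ≤ (1 - s) + s * d i := by
      have := min_le_left 1 (d i); have := min_le_right 1 (d i); nlinarith [hs.1, hs.2]
    have h1 : min 1 (d i) * ‖y i‖ ≤ ‖z i‖ := by
      rw [hzi, norm_mul, Real.norm_eq_abs ((1 - s) + s * d i), abs_of_pos ((hm i).trans_le hds)]
      gcongr
    have h2 : ‖y i‖ ≤ (1 / min 1 (d i)) * ‖z‖ := by
      rw [one_div, ← div_eq_inv_mul, le_div_iff₀ (hm i), mul_comm]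
      exact h1.trans (norm_le_pi_norm z i)
    refine h2.trans ?_
    gcongr
    exact Finset.single_le_sum (f := fun j => 1 / min 1 (d j)) (fun j _ => (one_div_pos.2 (hm j)).le)
      (Finset.mem_univ i)
  have hfam := toClass_precomp_eq_of_family φ (fun s => (diagonal fun i => (1 - s) + s * d i).mulVec)
    (Continuous.matrix_mulVec (A := fun p : (Fin k → ℝ) × ℝ => diagonal fun i => (1 - p.2) + p.2 * d i)
      (continuous_matrix fun i j => by
        simp only [diagonal_apply]; split_ifs <;> fun_prop) continuous_fst) C hcoer
    (h0 := continuous_const.matrix_mulVec continuous_id)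
    (h1 := continuous_const.matrix_mulVec continuous_id)
    (hC0 := hcoer 0 ⟨le_rfl, zero_le_one⟩) (hC1 := hcoer 1 ⟨zero_le_one, le_rfl⟩)
  have hzero : precomp φ (diagonal fun i => (1 - (0 : ℝ)) + 0 * d i).mulVec
      (continuous_const.matrix_mulVec continuous_id) C (hcoer 0 ⟨le_rfl, zero_le_one⟩) = φ :=
    ext fun y => by simp
  have hone : precomp φ (diagonal fun i => (1 - (1 : ℝ)) + 1 * d i).mulVec
      (continuous_const.matrix_mulVec continuous_id) C (hcoer 1 ⟨zero_le_one, le_rfl⟩) =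
      precompLin φ (diagonal d) h := ext fun y => by simp
  rw [← hone, ← hfam, hzero]

/-- Diagonal sign matrices: the class is inverted once per `-1`. Induction on the number of
negative entries, peeling off one `negMatrix` at a time. [folklore] -/
theorem toClass_precompLin_diagonal_sign [NeZero k] (n : ℕ) :
    ∀ (s : Fin k → ℝ), (∀ i, s i = 1 ∨ s i = -1) →
      (Finset.univ.filter fun i => s i = -1).card = n → ∀ (φ : CSphere k X x₀) h,
        (precompLin φ (diagonal s) h).toClass = φ.toClass ^ signDet (diagonal s) := by
  induction n with
  | zero =>
    intro s hs hcard φ h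
    have hs1 : s = 1 := by
      funext i
      rcases hs i with hi | hi
      · exact hi
      · exfalso
        rw [Finset.card_eq_zero, Finset.filter_eq_empty_iff] at hcard
        exact hcard (Finset.mem_univ i) hi
    subst hs1
    have hdet : 0 < (diagonal (1 : Fin k → ℝ)).det := by rw [det_diagonal]; simp
    rw [signDet_of_pos hdet, zpow_one]
    congr 1
    exact ext fun y => by simp
  | succ n ih =>
    intro s hs hcard φ h
    obtain ⟨b, hb⟩ : (Finset.univ.filter fun i => s i = -1).Nonempty := by
      rw [← Finset.card_pos, hcard]; exact Nat.succ_pos n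
    have hsb : s b = -1 := (Finset.mem_filter.1 hb).2
    -- peel off the coordinate `b`
    set s' : Fin k → ℝ := Function.update s b 1 with hs'
    have hs's : ∀ i, s' i = 1 ∨ s' i = -1 := fun i => by
      by_cases hi : i = b
      · left; rw [hs', hi, Function.update_self]
      · rw [hs', Function.update_of_ne hi]; exact hs i
    have hcard' : (Finset.univ.filter fun i => s' i = -1).card = n := by
      have heq : (Finset.univ.filter fun i => s' i = -1) =
          (Finset.univ.filter fun i => s i = -1).erase b := by
        ext i
        simp only [Finset.mem_filter, Finset.mem_univ, true_and, Finset.mem_erase]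
        by_cases hi : i = b
        · subst hi
          simp only [hs', Function.update_self, ne_eq, not_true_eq_false, false_and, iff_false]
          norm_num
        · simp [hs', hi]
      rw [heq, Finset.card_erase_of_mem hb, hcard]; rfl
    have hprod : diagonal s = diagonal s' * negMatrix b := by
      rw [negMatrix, diagonal_mul_diagonal]
      congr 1
      funext i
      by_cases hi : i = b
      · subst hi; rw [hs', Function.update_self, if_pos rfl, hsb]; norm_num
      · rw [hs', Function.update_of_ne hi, if_neg hi, mul_one]
    have hdet' : (diagonal s').det ≠ 0 := by
      rw [det_diagonal]
      exact Finset.prod_ne_zero_iff.2 fun i _ => by rcases hs's i with h' | h' <;> rw [h'] <;> norm_num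
    have hdetN : (negMatrix b).det ≠ 0 := by rw [det_negMatrix]; norm_num
    have hdetp : (diagonal s' * negMatrix b).det ≠ 0 := by
      rw [det_mul]; exact mul_ne_zero hdet' hdetN
    have key : precompLin φ (diagonal s) h = precompLin (precompLin φ (diagonal s') hdet')
        (negMatrix b) hdetN := by
      have := precompLin_mul φ hdet' hdetN hdetp
      rw [← this]
      congr 1
    rw [key, toClass_precompLin_neg, ih s' hs's hcard' φ hdet']
    have hsign : signDet (diagonal s) = signDet (diagonal s') * (-1) := by
      rw [hprod, signDet_mul hdet' hdetN,
        signDet_of_neg (show (negMatrix b).det < 0 by rw [det_negMatrix]; norm_num)]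
    rw [hsign, zpow_mul, zpow_neg_one]

/-- **Invertible diagonal matrices act by the sign of the determinant.** [folklore] -/
theorem toClass_precompLin_diagonal [NeZero k] (φ : CSphere k X x₀) {d : Fin k → ℝ}
    (h : (diagonal d).det ≠ 0) : (precompLin φ (diagonal d) h).toClass = φ.toClass ^ signDet (diagonal d) := by
  have hd : ∀ i, d i ≠ 0 := fun i hi => h (by
    rw [det_diagonal]; exact Finset.prod_eq_zero (Finset.mem_univ i) hi)
  -- `d = |d| * sign`
  set a : Fin k → ℝ := fun i => |d i| with ha
  set s : Fin k → ℝ := fun i => if d i < 0 then -1 else 1 with hs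
  have hsv : ∀ i, s i = 1 ∨ s i = -1 := fun i => by
    simp only [hs]; split_ifs <;> simp
  have has : diagonal d = diagonal a * diagonal s := by
    rw [diagonal_mul_diagonal]; congr 1; funext i
    simp only [ha, hs]
    split_ifs with hlt
    · rw [abs_of_neg hlt]; ring
    · rw [abs_of_nonneg (not_lt.1 hlt)]; ring
  have hapos : ∀ i, 0 < a i := fun i => abs_pos.2 (hd i)
  have hdeta : (diagonal a).det ≠ 0 := by
    rw [det_diagonal]; exact Finset.prod_ne_zero_iff.2 fun i _ => (hapos i).ne'
  have hdetapos : 0 < (diagonal a).det := by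
    rw [det_diagonal]; exact Finset.prod_pos fun i _ => hapos i
  have hdets : (diagonal s).det ≠ 0 := by
    rw [det_diagonal]
    exact Finset.prod_ne_zero_iff.2 fun i _ => by rcases hsv i with h' | h' <;> rw [h'] <;> norm_num
  have hdetp : (diagonal a * diagonal s).det ≠ 0 := by rw [det_mul]; exact mul_ne_zero hdeta hdets
  have key : precompLin φ (diagonal d) h =
      precompLin (precompLin φ (diagonal a) hdeta) (diagonal s) hdets := by
    rw [← precompLin_mul φ hdeta hdets hdetp]; congr 1
  rw [key, toClass_precompLin_diagonal_sign _ s hsv rfl _ hdets, toClass_precompLin_diagonal_pos _ hapos,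
    has, signDet_mul hdeta hdets, signDet_of_pos hdetapos, one_mul]

/-! #### All invertible matrices -/

/-- **Linear changes of coordinates act on `πₖ(X, x₀)` by the sign of the determinant**:
`toClass (φ ∘ M) = (toClass φ) ^ signDet M` for `det M ≠ 0`. By Mathlib's
`Matrix.diagonal_transvection_induction_of_det_ne_zero` from the cases of transvections and
diagonal matrices. [folklore] -/
theorem toClass_precompLin [NeZero k] (φ : CSphere k X x₀) (M : Matrix (Fin k) (Fin k) ℝ)
    (hM : M.det ≠ 0) : (precompLin φ M hM).toClass = φ.toClass ^ signDet M := by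
  revert φ
  refine diagonal_transvection_induction_of_det_ne_zero
    (fun M => ∀ (hM : M.det ≠ 0) (φ : CSphere k X x₀),
      (precompLin φ M hM).toClass = φ.toClass ^ signDet M) M hM ?_ ?_ ?_ hM
  · intro D hD hD' φ
    exact toClass_precompLin_diagonal φ hD'
  · intro t ht φ
    have hdet : 0 < t.toMatrix.det := by rw [TransvectionStruct.det]; exact one_pos
    rw [signDet_of_pos hdet, zpow_one]
    exact toClass_precompLin_transvection φ t.hij t.c
  · intro A B hA hB hPA hPB hAB φ
    rw [precompLin_mul φ hA hB hAB, hPB hB, hPA hA, ← zpow_mul, signDet_mul hA hB]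

/-! ### Translations and affine changes of coordinates -/

/-- **Precomposition with the translation** `y ↦ y + v`. [folklore] -/
def translate (φ : CSphere k X x₀) (v : Fin k → ℝ) : CSphere k X x₀ :=
  ⟨fun y => φ (y + v), by fun_prop, by
    obtain ⟨R, hR⟩ := φ.exists_bound
    refine ⟨R + ‖v‖, fun y hy => hR _ ?_⟩
    have := norm_sub_norm_le y (-v)
    rw [sub_neg_eq_add, norm_neg] at this
    linarith⟩

/-- Unfolding `translate`. [folklore] -/
@[simp] theorem translate_apply (φ : CSphere k X x₀) (v y : Fin k → ℝ) :
    translate φ v y = φ (y + v) := rfl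

/-- **Translations do not change the class** (join `v` to `0`). [folklore] -/
theorem toClass_translate [NeZero k] (φ : CSphere k X x₀) (v : Fin k → ℝ) :
    (translate φ v).toClass = φ.toClass := by
  obtain ⟨R, -, hR⟩ := φ.exists_bound_nonneg
  let Φ : ℝ → CSphere k X x₀ := fun s => translate φ (((projIcc 0 1 zero_le_one s : I) : ℝ) • v)
  have hΦ0 : Φ 0 = φ := ext fun y => by simp [Φ]
  have hΦ1 : Φ 1 = translate φ v := ext fun y => by simp [Φ]
  rw [← hΦ1]
  conv_rhs => rw [← hΦ0]
  have hΦc : Continuous fun p : (Fin k → ℝ) × ℝ => Φ p.2 p.1 := by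
    show Continuous fun p : (Fin k → ℝ) × ℝ => φ (p.1 + ((projIcc 0 1 zero_le_one p.2 : I) : ℝ) • v)
    fun_prop
  refine Eq.symm (homotopic_of_family Φ hΦc (R + ‖v‖) fun s _ y hy => hR _ ?_).toClass_eq
  show R ≤ ‖y + ((projIcc 0 1 zero_le_one s : I) : ℝ) • v‖
  have hs := (projIcc 0 1 zero_le_one s).2
  have h1 := norm_sub_norm_le y (-(((projIcc 0 1 zero_le_one s : I) : ℝ) • v))
  rw [sub_neg_eq_add, norm_neg, norm_smul, Real.norm_eq_abs, abs_of_nonneg hs.1] at h1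
  nlinarith [norm_nonneg v, hs.2]

/-- An **affine change of coordinates** of `ℝᵏ`: `y ↦ lin y + shift`. [folklore] -/
structure AffMap (k : ℕ) where
  /-- the linear part -/
  lin : Matrix (Fin k) (Fin k) ℝ
  /-- the translation part -/
  shift : Fin k → ℝ

namespace AffMap

/-- An affine change of coordinates as a function. [folklore] -/
instance : CoeFun (AffMap k) fun _ => (Fin k → ℝ) → (Fin k → ℝ) := ⟨fun A y => A.lin *ᵥ y + A.shift⟩

/-- Unfolding the action. [folklore] -/
theorem apply_def (A : AffMap k) (y : Fin k → ℝ) : A y = A.lin *ᵥ y + A.shift := rfl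

/-- Affine changes of coordinates are continuous. [folklore] -/
@[fun_prop]
theorem continuous (A : AffMap k) : Continuous (A : (Fin k → ℝ) → (Fin k → ℝ)) :=
  (continuous_const.matrix_mulVec continuous_id).add continuous_const

/-- Composition of affine changes of coordinates. [folklore] -/
def comp (A B : AffMap k) : AffMap k := ⟨A.lin * B.lin, A.lin *ᵥ B.shift + A.shift⟩

/-- Composition acts as composition. [folklore] -/
@[simp] theorem comp_apply (A B : AffMap k) (y : Fin k → ℝ) : (A.comp B) y = A (B y) := by
  show (A.lin * B.lin) *ᵥ y + (A.lin *ᵥ B.shift + A.shift) = A.lin *ᵥ (B.lin *ᵥ y + B.shift) + A.shift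
  rw [mulVec_add, mulVec_mulVec]; abel

/-- The linear part of a composition. [folklore] -/
@[simp] theorem comp_lin (A B : AffMap k) : (A.comp B).lin = A.lin * B.lin := rfl

/-- **Affine maps preserve affine combinations.** [folklore] -/
theorem apply_affineCombination (A : AffMap k) {ι : Type*} (s : Finset ι) (w : ι → ℝ)
    (q : ι → Fin k → ℝ) (hw : ∑ i ∈ s, w i = 1) :
    A (∑ i ∈ s, w i • q i) = ∑ i ∈ s, w i • A (q i) := by
  show A.lin *ᵥ (∑ i ∈ s, w i • q i) + A.shift = ∑ i ∈ s, w i • (A.lin *ᵥ q i + A.shift)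
  simp only [mulVec_sum, mulVec_smul, smul_add, Finset.sum_add_distrib, ← Finset.sum_smul,
    hw, one_smul]

/-- The value at the origin is the shift. [folklore] -/
@[simp] theorem apply_zero (A : AffMap k) : A 0 = A.shift := by
  show A.lin *ᵥ 0 + A.shift = A.shift; simp

/-- The value at a basis vector is the corresponding column plus the shift. [folklore] -/
theorem apply_single (A : AffMap k) (i : Fin k) :
    A (Pi.single i 1) = (fun j => A.lin j i) + A.shift := by
  show A.lin *ᵥ Pi.single i 1 + A.shift = _
  rw [mulVec_single_one]
  rfl

end AffMap

/-- **Precomposition with an invertible affine change of coordinates.** [folklore] -/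
def precompAff (φ : CSphere k X x₀) (A : AffMap k) (hA : A.lin.det ≠ 0) : CSphere k X x₀ :=
  precompLin (translate φ A.shift) A.lin hA

/-- Unfolding `precompAff`. [folklore] -/
@[simp] theorem precompAff_apply (φ : CSphere k X x₀) (A : AffMap k) (hA : A.lin.det ≠ 0)
    (y : Fin k → ℝ) : precompAff φ A hA y = φ (A y) := rfl

/-- **Affine changes of coordinates act on `πₖ(X, x₀)` by the sign of the determinant.**
[folklore] -/
theorem toClass_precompAff [NeZero k] (φ : CSphere k X x₀) (A : AffMap k) (hA : A.lin.det ≠ 0) :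
    (precompAff φ A hA).toClass = φ.toClass ^ signDet A.lin := by
  rw [precompAff, toClass_precompLin, toClass_translate]

end CSphere

end Literature.AlgebraicTopology.Homotopy

end
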